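import Literature.MathematicalPhysics.QuantumFieldTheory.Balaban1983to89.B8Ineq132
import Literature.MathematicalPhysics.QuantumFieldTheory.Balaban1983to89.B8ConstraintBonds
import Literature.MathematicalPhysics.QuantumFieldTheory.Balaban1983to89.B11

/-!
# `Balaban1983to89.B11Eq7Convention` — T. Bałaban, *The variational problem and background fields in renormalization
# group method for lattice gauge theories*, Commun. Math. Phys. **102** (1985) 277–309 [Balaban1985Variational], p. 278:
# the constraint space (3) `𝔅_k(𝔅_k, V)` and the regularity hypothesis (7) `|(∂V)(p′) − 1| < ε₁, p′ ∈ 𝔅_k` WITH ITS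
# PRINTED BOUNDARY CONVENTION ("we replace V_b by V̄_b"), typed over the concrete `ℤ^d` lattices of the lineage
# (`B7Prop1Explicit`/`B7Prop2Explicit`: `Ū^j = avgIter`), with the block geometry of the admissible domain sequences
# (1) (= (1.3)–(1.4) of [6], the tree's `B8ConstraintBonds.DomainSeq`) that the remark after (7) uses

statement-level skeleton of published theorems with citation tags; proofs where landed; nothing here is a claim
about the Yang–Mills mass gap

PDF held: `paper:balaban1985-cmp102-variational-background` (journal page = PDF page + 276); p. 278 (PDF 2) read from
the held text AND from the x2 page render `pub-balaban/b2b-balaban-ref1/pages/1985-cmp102-variational-background/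
…-p002-x2.png` (displays (2)–(7) and the explanation of (7), read as an image); the conventions "p ∈ Ω", "b ∈ Ω" (at
least one corner / end-point in `Ω`), (1.3)–(1.5), (1.12)–(1.13) from the renders `…/1985-cmp99-regular-spaces-gauge-
fixing-p003-x2.png`, `-p004-x2.png` of [6] = T. Bałaban, *Spaces of regular gauge field configurations on a lattice and
gauge fixing conditions*, CMP **99** (1985) 75–102 [Balaban1985RegularSpaces] (cell paper B8); "[4]" = T. Bałaban,
*Averaging operations for lattice gauge theories*, CMP **98** (1985) 17–51 [Balaban1985Averaging] (B7): the averages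
(42)/(43) (`B7Prop1Explicit.bavg`, `B7Prop2Explicit.avgIter`) and their locality p. 24 (`B7Prop1Local`).

WHAT IS REPRODUCED.  The concrete objects behind SKELETON rows `B11.Eq3` ((3), decl of record `B11.VarProblem.InB`,
abstract), `B11.Eq7` ((7) "with the boundary convention V_b ↦ V̄_b for b ∉ Λ_j", decl of record `B11.VarProblem.Reg7`,
abstract) and the geometry used by `B11.Rem@278` (the remark after (7), PROVED in the companion `B11Rem278`):
`InB` = (3), `effCfg`/`PlaqB`/`Reg7` = (7) with its convention, over `B8Ineq132`'s fine site sets `Ω : ℕ → Set (Site d)`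
(the space (2) = `B8Ineq132.InAk`), and the concrete model `concreteVarProblem` of the abstract carrier `B11.VarProblem`
((2), (3), (7) concrete; the fields the remark does not involve supplied by arbitrary data `OtherData`), the family over
which `B11Rem278` discharges the row's decl `B11.Prop2OfB7Shape`.  Mega-formalization `lit-balaban`, HOME `run/shared/lean/pub/lit-balaban/`,
Phase-2 proof seat `p29` gen 3, unit `lit-balaban-p29`.  No row status is claimed for B11.Eq3/B11.Eq7 here (owner r08).

THE PRINTED TEXT (p. 278, verbatim).  *"The space 𝔘_k({Ω_j}, ε₀) of gauge field configuration[s] on Ω₀ was defined in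
Sect. A of [6] by the conditions |U(∂p) − 1| = |(∂U)(p) − 1| < ε₀L^{−2j} = ε₀η²(L^jη)^{−2} for p ∈ Ω_j, j = 0, 1, …, k,
|(D^{η*}_U ∂U)(b)| < ε₀L^{−2j}(L^jη)^{−1} = ε₀η²(L^jη)^{−3} for b ∈ Ω_j, (2) where ε₀ > 0, and the space 𝔅_k(𝔅_k, V)
by the conditions Ū^j = V on Λ_j, j = 0, 1, …, k, (3) where V is a fixed gauge field configuration define[d] on 𝔅_k.
… More precisely we assume that |(∂V)(p′) − 1| < ε₁ for p′ ∈ 𝔅_k (7) for ε₁ sufficiently small. This requires an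
explanation. For some j between 0 and k p′ ∈ Λ_j. If p′ ⊂ Λ_j, i.e. all four vertices of p′ belong to Λ_j, then the
meaning of the symbol (∂V)(p′) is simple, then all four bonds of the boundary ∂p′ belong to Λ_j and we have (∂V)(p′) =
V(∂p′). If p′ intersects the boundary of Λ_j, then some bonds b do not belong to Λ_j and we replace V_b by V̄_b in the
above equality. For example if p′ = ⟨x,y⟩ ∪ ⟨y,z⟩ ∪ ⟨z,w⟩ ∪ ⟨w,x⟩ and ⟨y,z⟩ do[es] not belong to Λ_j, then it means
that y, z ∈ Λ_{j−1} and we define (∂V)(p′) = V(x,y)V̄(y,z)V(z,w)V(w,x)."*  [6] p. 77: *"If Ω ⊂ T_η, then we denote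
by Ω also the set of bonds ⋃_{x∈Ω} st(x) = {bonds b ⊂ T_η: at least one end-point of b belongs to Ω}. Similarly for
the corresponding set of plaquettes. … Λ_j = Ω_j^{(j)} \ Ω_{j+1}^{(j)}, j = 0, 1, …, k − 1, Λ_k = Ω_k^{(k)}, (1.5) …
we admit the case where some domains Ω_j are equal to T_η"*; p. 77 (1.4): *"Ω_j = B^j(Ω_j^{(j)}), Ω_j is a sum of
cubes of a size M₁L^jη, (L^jη)^{−1}dist(Ω_j^c, Ω_{j+1}) > RM₁"* (= (1) p. 277 of the paper).

MODEL / DECLARED DEVIATIONS (referee columns F6/F7; those of `B7Prop2Explicit` (b)–(e) and `B8Ineq132` inherited).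
(M1) LATTICES: `T_η ↦ ℤ^d` (`B7Prop1Explicit.Site d`, no torus), `η = L^{−k}`; the level-`j` lattice `L^jηℤ^d` is
`ℤ^d` in its own coordinates (DICTIONARY of `B7Prop2Explicit`: `Ū^j = avgIter L U j`); the domains are fine site sets
`Ω : ℕ → Set (Site d)` as in `B8Ineq132.InAk` (= the space (2), which B11 takes from Sect. A of [6]); the level-`j`
point `y` lies in `Ω_n^{(j)} = Ω_n ∩ T^{(j)}` iff `L^j y ∈ Ω n` (`B7Prop1Local.loK`), so `Λ_j` = `Lam L Ω k j` =
`loK⁻¹(B8Ineq132.layer Ω k j)`.  (M2) ADMISSIBILITY (1) = (1.3)–(1.4) of [6] enters through the tree's decl of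
record `B8ConstraintBonds.DomainSeq` (nesting, block saturation `Ω_j = B^j(Ω_j^{(j)})`, and the separation collar "the
`ℓ^∞`-ball of radius `L^{j+1}` about a point of `Ω_{j+1}` lies in `Ω_j`", its reading of `(L^jη)^{−1}dist(Ω_j^c,
Ω_{j+1}) > RM₁`, `RM₁ ≥ L`) together with `Ω 0 = T_η` where needed ([6] p. 77 "we admit … Ω_j = T_η"; in (6) `U` is a
configuration on `Ω₀`, the whole lattice of the problem); the two consequences used are `mem_iff_of_under` (blocks)
and `mem_of_fatBlock` (the `3^d` blocks `B^j(y′)`, `|y′ − y|_∞ ≤ 1`, around a point `y ∈ Ω_j^{(j)}` lie in `Ω_{j−1}`).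
(M3) THE DATA `V` on `𝔅_k` ↦ a family `V : ℕ → (Site d → Fin d → 𝔸ˣ)` (level-`j` data in level-`j` coordinates; only
its values on the bonds touching `Λ_j` are "V on 𝔅_k"); (3) ↦ `InB` (every level-`j` bond with at least one end-point
in `Λ_j`, the p. 77 convention of [6], read literally; cf. `B8ConstraintBonds.literalBonds` and the located gap
G-adv8-10 recorded there — the repairs R_A/R_B constrain fewer bonds, (3) literal is the printed hypothesis).
(M4) THE PLAQUETTE SET OF (7): print assigns to `p′ ∈ Λ_j` (touching `Λ_j`) the product over `∂p′` with `V_b` on the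
bonds touching `Λ_j` and `V̄_b` (one-step average (42) of the level-`(j−1)` data) on the others, which it asserts lie
over `Λ_{j−1}` ("then it means that y, z ∈ Λ_{j−1}"); a bond of `p′` with both end-points in `Ω_{j+1}^{(j)}` (possible
at a re-entrant corner of `Ω_{j+1}`) carries neither a value of `V` nor of `V̄`, and `(∂V)(p′)` is undefined there: the
level-`j` plaquettes of (7) are typed as `PlaqB` = touching `Λ_j` AND every bond either touching `Λ_j` or lying outside
`Ω_j^{(j)}` (`BondOK`) — exactly the plaquettes for which the printed recipe defines `(∂V)(p′)`; `effCfg` is that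
recipe (at level `0`, where `Ω₀ = T_η`, just `V`).  Plaquettes `(y; μ, ν)` are taken for all `μ ≠ ν` (both
orientations, as in `B8Ineq132`).  Net new unproved facts: 0 (definitions with bodies + proved lemmas).
-/

noncomputable section

open scoped BigOperators
open NormedSpace Finset

namespace Literature.MathematicalPhysics.QuantumFieldTheory.Balaban1983to89.B11Eq7Convention

open B7Prop1Explicit B7Prop2Explicit B7Prop1Local B8Ineq132
open Literature.MathematicalPhysics.QuantumLattice (blockMap blockBase blockMap_blockBase_add_of_lt)
open B8ConstraintBonds (DomainSeq)

-- `Site` alone could resolve to the torus sites of `Setup.lean` through a parent namespace; re-export the `ℤ^d`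
-- sites `Fin d → ℤ` of `B7Prop1Explicit`.
export B7Prop1Explicit (Site)

variable {d : ℕ}

/-! ## §1 Geometry of the level sets in the coordinates of the `L^jη`-lattices -/

section Geometry

/-- **`Λ_j`** in the coordinates of the `L^jη`-lattice: the level-`j` point `y` belongs to `Λ_j = Ω_j^{(j)} \
Ω_{j+1}^{(j)}` (`j < k`), `Λ_k = Ω_k^{(k)}`, iff the fine site `L^j y` lies in `B^j(Λ_j) = Ω_j \ Ω_{j+1}`
(`B8Ineq132.layer`; `Ω_n^{(j)} = Ω_n ∩ T^{(j)}`). [cite: Balaban1985Variational, (3) p.278; Balaban1985RegularSpaces, (1.5) p.77] -/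
def Lam (L : ℕ) (Ω : ℕ → Set (Site d)) (k j : ℕ) : Set (Site d) := {y | loK L j y ∈ layer Ω k j}

/-- The four vertices `x, y, z, w` of the plaquette `p′ = ⟨x,y⟩ ∪ ⟨y,z⟩ ∪ ⟨z,w⟩ ∪ ⟨w,x⟩` with lower-left corner `y`
spanned by `e_μ, e_ν`. [cite: Balaban1985Variational, p.278 (explanation of (7))] -/
def IsCorner (y : Site d) (μ ν : Fin d) (c : Site d) : Prop :=
  c = y ∨ c = y + e μ ∨ c = y + e ν ∨ c = y + e μ + e ν

/-! ### The admissibility (1) = (1.3)–(1.4) of [6]: the tree's `B8ConstraintBonds.DomainSeq`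

The domain sequence enters through the decl of record `B8ConstraintBonds.DomainSeq L Ω` (nesting `anti`, block
saturation `sat` = "`Ω_j = B^j(Ω_j^{(j)})`", separation `sep` = the collar form of "`(L^jη)^{−1}dist(Ω_j^c, Ω_{j+1}) >
RM₁`") together with `Ω 0 = T_η` ([6] p. 77: "we admit the case where some domains `Ω_j` are equal to `T_η`"; in (6)
`U` is a configuration on `Ω₀`, the whole lattice of the problem); the two consequences used below are `mem_iff_of_under`
(blocks) and `mem_of_fatBlock` (collar). -/

/-- A fine site of the `j`-block `B^j(y) = L^j y + [0, L^j)^d` (`B8Ineq132.Under`; (2) of [4]: "B^j(y) = {x :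
y_μ ≤ x_μ < y_μ + L^jη}") has block label `y` (`blockMap (L^j)` of the prelude). [cite: Balaban1985Averaging, (2) p.17] -/
theorem blockMap_eq_of_under {L j : ℕ} {y z : Site d} (hz : Under L j y z) : blockMap (L ^ j) z = y := by
  have ht : z = blockBase (L ^ j) y + (z - blockBase (L ^ j) y) := by abel
  rw [ht]
  refine blockMap_blockBase_add_of_lt (L ^ j) y _ (fun i => ?_) (fun i => ?_)
  · have h := (hz i).1
    simp only [Pi.sub_apply, blockBase, Nat.cast_pow]
    linarith
  · have h := (hz i).2
    simp only [Pi.sub_apply, blockBase, Nat.cast_pow]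
    linarith

/-- The corner `L^j y` lies in its own block `B^j(y)` (`L ≥ 1`; (2) of [4]). [cite: Balaban1985Averaging, (2) p.17] -/
theorem under_loK_self {L : ℕ} (hL : 1 ≤ L) (j : ℕ) (y : Site d) : Under L j y (loK L j y) := fun i => by
  have hP : (1 : ℤ) ≤ (L : ℤ) ^ j := one_le_pow₀ (by exact_mod_cast hL)
  simp only [loK]
  constructor <;> nlinarith

/-- **`Ω_j = B^j(Ω_j^{(j)})`** ((1); `DomainSeq.sat`): a fine site of the `j`-block of `y` lies in `Ω_j` iff the corner
`L^j y` does, i.e. iff `y ∈ Ω_j^{(j)}`. [cite: Balaban1985Variational, (1) p.277; Balaban1985RegularSpaces, (1.4) p.77] -/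
theorem mem_iff_of_under {L : ℕ} (hL : 1 ≤ L) {Ω : ℕ → Set (Site d)} (hΩ : DomainSeq L Ω) {j : ℕ} {y z : Site d}
    (hz : Under L j y z) : z ∈ Ω j ↔ loK L j y ∈ Ω j :=
  ⟨hΩ.sat j z _ ((blockMap_eq_of_under hz).trans (blockMap_eq_of_under (under_loK_self hL j y)).symm),
    hΩ.sat j _ z ((blockMap_eq_of_under (under_loK_self hL j y)).trans (blockMap_eq_of_under hz).symm)⟩

/-- **The collar of (1)** (`(L^jη)^{−1}dist(Ω_j^c, Ω_{j+1}) > RM₁`; `DomainSeq.sep`): if `L^{j+1}y ∈ Ω_{j+1}`, the union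
of the `3^d` blocks `B^{j+1}(y′)`, `|y′ − y|_∞ ≤ 1` — the fine box `[L^{j+1}(y − 𝟙), L^{j+1}(y + 2·𝟙) − 𝟙]` — lies in
`Ω_j` (each of its sites is within `ℓ^∞`-distance `L^{j+1}` of the block `B^{j+1}(y) ⊂ Ω_{j+1}`).
[cite: Balaban1985Variational, (1) p.277; Balaban1985RegularSpaces, (1.4) p.77] -/
theorem mem_of_fatBlock {L : ℕ} (hL : 1 ≤ L) {Ω : ℕ → Set (Site d)} (hΩ : DomainSeq L Ω) {j : ℕ} {y : Site d}
    (hy : loK L (j + 1) y ∈ Ω (j + 1)) {z : Site d}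
    (hz : ∀ i, (L : ℤ) ^ (j + 1) * (y i - 1) ≤ z i ∧ z i + 1 ≤ (L : ℤ) ^ (j + 1) * (y i + 2)) : z ∈ Ω j := by
  have hP : (1 : ℤ) ≤ (L : ℤ) ^ (j + 1) := one_le_pow₀ (by exact_mod_cast hL)
  -- the site of `B^{j+1}(y)` nearest to `z`
  set hi : Site d := fun i => (L : ℤ) ^ (j + 1) * y i + ((L : ℤ) ^ (j + 1) - 1) with hhi
  set x : Site d := clamp (loK L (j + 1) y) hi z with hx
  have hxi : ∀ i, x i = max ((L : ℤ) ^ (j + 1) * y i) (min (z i) ((L : ℤ) ^ (j + 1) * y i + ((L : ℤ) ^ (j + 1) - 1))) :=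
    fun i => rfl
  have hux : Under L (j + 1) y x := fun i => by
    rw [hxi]
    refine ⟨le_max_left _ _, ?_⟩
    have : max ((L : ℤ) ^ (j + 1) * y i) (min (z i) ((L : ℤ) ^ (j + 1) * y i + ((L : ℤ) ^ (j + 1) - 1))) ≤
        (L : ℤ) ^ (j + 1) * y i + ((L : ℤ) ^ (j + 1) - 1) := max_le (by linarith) (min_le_right _ _)
    linarith
  have hxΩ : x ∈ Ω (j + 1) := (mem_iff_of_under hL hΩ hux).2 hy
  have hzx : z = x + (z - x) := by abel
  rw [hzx]
  refine hΩ.sep j x (z - x) hxΩ fun i => ?_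
  rw [Pi.sub_apply, abs_le, hxi]
  obtain ⟨h1, h2⟩ := hz i
  constructor
  · have : max ((L : ℤ) ^ (j + 1) * y i) (min (z i) ((L : ℤ) ^ (j + 1) * y i + ((L : ℤ) ^ (j + 1) - 1))) ≤
        z i + (L : ℤ) ^ (j + 1) := max_le (by linarith) ((min_le_left _ _).trans (by linarith))
    linarith
  · by_cases hzi : z i ≤ (L : ℤ) ^ (j + 1) * y i + ((L : ℤ) ^ (j + 1) - 1)
    · have : z i ≤ max ((L : ℤ) ^ (j + 1) * y i) (min (z i) ((L : ℤ) ^ (j + 1) * y i + ((L : ℤ) ^ (j + 1) - 1))) :=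
        (min_eq_left hzi).symm.le.trans (le_max_right _ _)
      linarith
    · have : (L : ℤ) ^ (j + 1) * y i + ((L : ℤ) ^ (j + 1) - 1) ≤
          max ((L : ℤ) ^ (j + 1) * y i) (min (z i) ((L : ℤ) ^ (j + 1) * y i + ((L : ℤ) ^ (j + 1) - 1))) :=
        (min_eq_right (not_le.mp hzi).le).symm.le.trans (le_max_right _ _)
      linarith

/-- Coordinates of the four vertices `x, y, z, w` of `p′`: `y_i ≤ c_i ≤ y_i + [i ∈ {μ, ν}]` (`μ ≠ ν`).
[cite: Balaban1985Variational, p.278 (explanation of (7): "p′ = ⟨x,y⟩ ∪ ⟨y,z⟩ ∪ ⟨z,w⟩ ∪ ⟨w,x⟩")] -/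
theorem IsCorner.bounds {y : Site d} {μ ν : Fin d} (hμν : μ ≠ ν) {c : Site d} (hc : IsCorner y μ ν c) (i : Fin d) :
    y i ≤ c i ∧ c i ≤ y i + if i = μ ∨ i = ν then 1 else 0 := by
  rcases hc with rfl | rfl | rfl | rfl <;>
    simp only [Pi.add_apply, e_apply, le_refl, true_and] <;> split_ifs <;> omega

/-- Two vertices of the plaquette `p′` are at sup-distance `≤ 1`.
[cite: Balaban1985Variational, p.278 (explanation of (7): "p′ = ⟨x,y⟩ ∪ ⟨y,z⟩ ∪ ⟨z,w⟩ ∪ ⟨w,x⟩")] -/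
theorem IsCorner.dist_le {y : Site d} {μ ν : Fin d} (hμν : μ ≠ ν) {c c' : Site d} (hc : IsCorner y μ ν c)
    (hc' : IsCorner y μ ν c') (i : Fin d) : c' i - 1 ≤ c i ∧ c i ≤ c' i + 1 := by
  have h1 := hc.bounds hμν i
  have h2 := hc'.bounds hμν i
  split_ifs at h1 h2 <;> omega

/-- "p′ ∈ S" (touching) ⟺ some vertex of `p′` lies in `S`. [cite: Balaban1985RegularSpaces, p.77 (convention before (1.5))] -/
theorem exists_corner_of_plaqTouches {S : Set (Site d)} {y : Site d} {μ ν : Fin d} (h : PlaqTouches S y μ ν) :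
    ∃ c, IsCorner y μ ν c ∧ c ∈ S := by
  rcases h with h | h | h | h
  exacts [⟨_, Or.inl rfl, h⟩, ⟨_, Or.inr (Or.inl rfl), h⟩, ⟨_, Or.inr (Or.inr (Or.inl rfl)), h⟩,
    ⟨_, Or.inr (Or.inr (Or.inr rfl)), h⟩]

/-- The `(j+1)`-block of a vertex `c` of a plaquette one of whose vertices `y₀` lies in `Λ_{j+1}` is contained in
`Ω_j` (collar of (1)). [cite: Balaban1985Variational, (1) p.277, p.278 ("it means that y, z ∈ Λ_{j−1}")] -/
theorem mem_of_under_corner {L : ℕ} (hL : 1 ≤ L) {Ω : ℕ → Set (Site d)} (hΩ : DomainSeq L Ω) {k j : ℕ}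
    {y : Site d} {μ ν : Fin d} (hμν : μ ≠ ν) {y₀ : Site d} (hy₀c : IsCorner y μ ν y₀) (hy₀ : y₀ ∈ Lam L Ω k (j + 1))
    {c : Site d} (hc : IsCorner y μ ν c) {z : Site d} (hz : Under L (j + 1) c z) : z ∈ Ω j := by
  refine mem_of_fatBlock hL hΩ hy₀.1 fun i => ?_
  have hP : (0 : ℤ) ≤ (L : ℤ) ^ (j + 1) := by positivity
  have hd := hc.dist_le hμν hy₀c i
  have h1 : (L : ℤ) ^ (j + 1) * (y₀ i - 1) ≤ (L : ℤ) ^ (j + 1) * c i := mul_le_mul_of_nonneg_left hd.1 hP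
  have h2 : (L : ℤ) ^ (j + 1) * (c i + 1) ≤ (L : ℤ) ^ (j + 1) * (y₀ i + 2) :=
    mul_le_mul_of_nonneg_left (by omega) hP
  exact ⟨h1.trans (hz i).1, (hz i).2.trans h2⟩

/-- … and, if `L^{j+1}c ∉ Ω_{j+1}` (the vertex lies outside `Ω_{j+1}^{(j+1)}`), the block misses `Ω_{j+1}`
(`Ω_{j+1} = B^{j+1}(Ω_{j+1}^{(j+1)})`), so it lies in `B^j(Λ_j) = Ω_j \ Ω_{j+1}`: print's "then it means that
y, z ∈ Λ_{j−1}". [cite: Balaban1985Variational, p.278 (explanation of (7))] -/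
theorem mem_layer_of_under_corner {L : ℕ} (hL : 1 ≤ L) {Ω : ℕ → Set (Site d)} (hΩ : DomainSeq L Ω) {k j : ℕ}
    {y : Site d} {μ ν : Fin d} (hμν : μ ≠ ν) {y₀ : Site d} (hy₀c : IsCorner y μ ν y₀)
    (hy₀ : y₀ ∈ Lam L Ω k (j + 1)) {c : Site d} (hc : IsCorner y μ ν c) (hcΩ : loK L (j + 1) c ∉ Ω (j + 1))
    {z : Site d} (hz : Under L (j + 1) c z) : z ∈ layer Ω k j :=
  ⟨mem_of_under_corner hL hΩ hμν hy₀c hy₀ hc hz, fun _ h => hcΩ ((mem_iff_of_under hL hΩ hz).1 h)⟩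

/-- A level-`j` point `w` with `L c ≤ w < L(c + 𝟙)` (i.e. `w ∈ B(c)`, (2) of [4] with `j = 1` on the `L^jη`-lattice)
has its fine site `L^j w` in the `(j+1)`-block `B^{j+1}(c)` (the nesting of the blocks (2)). [cite: Balaban1985Averaging, (2) p.17] -/
theorem under_loK_of_block {L : ℕ} (hL : 1 ≤ L) (j : ℕ) {c w : Site d}
    (h : ∀ i, (L : ℤ) * c i ≤ w i ∧ w i + 1 ≤ (L : ℤ) * (c i + 1)) : Under L (j + 1) c (loK L j w) := by
  intro i
  have hP : (1 : ℤ) ≤ (L : ℤ) ^ j := one_le_pow₀ (by exact_mod_cast hL)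
  obtain ⟨h1, h2⟩ := h i
  have h1' := mul_le_mul_of_nonneg_left h1 (zero_le_one.trans hP)
  have h2' := mul_le_mul_of_nonneg_left h2 (zero_le_one.trans hP)
  simp only [loK, pow_succ]
  constructor <;> nlinarith

/-- The level-`j` points of the box `B(c) ∪ B(c + e_κ)` underlying the one-step average at the bond `⟨c, c + e_κ⟩` of
the `(j+1)`-st lattice ([4] p. 24) have their fine sites in `B^{j+1}(c) ∪ B^{j+1}(c + e_κ)`. [cite: Balaban1985Averaging, p.24 (sentence after (43))] -/
theorem under_of_bondBox {L : ℕ} (hL : 1 ≤ L) (j : ℕ) {c w : Site d} {κ : Fin d}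
    (hw : InBox ((L : ℤ) • c) (bondHi L ((L : ℤ) • c) κ) w) :
    Under L (j + 1) c (loK L j w) ∨ Under L (j + 1) (c + e κ) (loK L j w) := by
  by_cases hκ : w κ + 1 ≤ (L : ℤ) * (c κ + 1)
  · refine Or.inl (under_loK_of_block hL j fun i => ?_)
    have h := hw i
    simp only [bondHi, Pi.smul_apply, smul_eq_mul] at h
    by_cases hi : i = κ
    · subst hi; exact ⟨h.1, hκ⟩
    · rw [if_neg hi] at h; constructor <;> nlinarith [h.1, h.2]
  · refine Or.inr (under_loK_of_block hL j fun i => ?_)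
    have h := hw i
    simp only [bondHi, Pi.smul_apply, smul_eq_mul, add_e_apply] at h ⊢
    by_cases hi : i = κ
    · subst hi; rw [if_pos rfl] at h ⊢; constructor <;> nlinarith [h.1, h.2]
    · rw [if_neg hi] at h ⊢; constructor <;> nlinarith [h.1, h.2]

/-- A fine site of the union `B^j(x) ∪ B^j(y) ∪ B^j(z) ∪ B^j(w)` of the four `j`-blocks at the corners of a level-`j`
plaquette ([4] p. 26, the locality sentence after (54); box `[loK, plaqHiK]` of `B7Prop1Local`) lies in the `j`-block of
one of its vertices. [cite: Balaban1985Averaging, p.26 (sentence after (54)), (2) p.17] -/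
theorem exists_corner_under {L : ℕ} (hL : 1 ≤ L) (j : ℕ) {y : Site d} {μ ν : Fin d} (hμν : μ ≠ ν) {x : Site d}
    (hx : InBox (loK L j y) (plaqHiK L j y μ ν) x) : ∃ c, IsCorner y μ ν c ∧ Under L j c x := by
  have hP : (1 : ℤ) ≤ (L : ℤ) ^ j := one_le_pow₀ (by exact_mod_cast hL)
  have hlo : ∀ i, (L : ℤ) ^ j * y i ≤ x i := fun i => (hx i).1
  have hhi : ∀ i, x i ≤ (L : ℤ) ^ j * y i + ((L : ℤ) ^ j - 1) + if i = μ ∨ i = ν then (L : ℤ) ^ j else 0 :=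
    fun i => (hx i).2
  -- in the directions `μ`, `ν`: which half of the box
  have half : ∀ i, i = μ ∨ i = ν → ∃ a : ℤ, (a = 0 ∨ a = 1) ∧
      (L : ℤ) ^ j * (y i + a) ≤ x i ∧ x i + 1 ≤ (L : ℤ) ^ j * (y i + a + 1) := by
    intro i hi
    have h2 := hhi i
    rw [if_pos hi] at h2
    by_cases h : (L : ℤ) ^ j * (y i + 1) ≤ x i
    · exact ⟨1, Or.inr rfl, h, by linarith⟩
    · exact ⟨0, Or.inl rfl, by linarith [hlo i], by linarith [not_le.mp h]⟩
  obtain ⟨a, ha01, ha⟩ := half μ (Or.inl rfl)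
  obtain ⟨b, hb01, hb⟩ := half ν (Or.inr rfl)
  refine ⟨y + a • e μ + b • e ν, ?_, fun i => ?_⟩
  · rcases ha01 with rfl | rfl <;> rcases hb01 with rfl | rfl <;> simp [IsCorner]
  · simp only [Pi.add_apply, Pi.smul_apply, e_apply, smul_eq_mul, mul_ite, mul_one, mul_zero]
    by_cases hiμ : i = μ
    · subst hiμ
      rw [if_pos rfl, if_neg hμν, add_zero]
      exact ha
    · by_cases hiν : i = ν
      · subst hiν
        rw [if_neg hiμ, if_pos rfl, add_zero]
        exact hb
      · have hμν' : ¬ (i = μ ∨ i = ν) := by tauto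
        have h2 := hhi i
        rw [if_neg hμν'] at h2
        rw [if_neg hiμ, if_neg hiν, add_zero, add_zero]
        exact ⟨hlo i, by linarith⟩

end Geometry

/-! ## §2 The spaces (3), (6) and the regularity (7) with its boundary convention, on the concrete lattices -/

section Objects

variable {𝔸 : Type*} [NormedRing 𝔸] [NormOneClass 𝔸] [NormedAlgebra ℂ 𝔸] [CompleteSpace 𝔸]

omit [NormOneClass 𝔸] in
/-- **(3) `U ∈ 𝔅_k(𝔅_k, V)`: "Ū^j = V on Λ_j, j = 0, 1, …, k"** — at every bond of the `L^jη`-lattice with at least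
one end-point in `Λ_j` ([6] p. 77 convention) the `j`-fold average (43) of [4] of `U` equals the level-`j` datum.
((2) `U ∈ 𝔘_k({Ω_j}, ε₀)` is the tree's `B8Ineq132.InAk`.) [cite: Balaban1985Variational, (3) p.278; Balaban1985RegularSpaces, (1.13) p.78] -/
def InB (L k : ℕ) (Ω : ℕ → Set (Site d)) (V : ℕ → Site d → Fin d → 𝔸ˣ) (U : Site d → Fin d → 𝔸ˣ) : Prop :=
  ∀ j, j ≤ k → ∀ (y : Site d) (κ : Fin d), BondTouches (Lam L Ω k j) y κ → avgIter L U j y κ = V j y κ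

open Classical in
omit [NormOneClass 𝔸] in
/-- **The recipe of (7)**: on the bonds of the `L^jη`-lattice touching `Λ_j` the datum `V`, on the others `V̄`, the
one-step average (42) of the level-`(j−1)` datum ("we replace V_b by V̄_b"); at level `0` (`Ω₀ = T_η`) just `V`.
[cite: Balaban1985Variational, p.278 (explanation of (7))] -/
def effCfg (L k : ℕ) (Ω : ℕ → Set (Site d)) (V : ℕ → Site d → Fin d → 𝔸ˣ) : ℕ → Site d → Fin d → 𝔸ˣ
  | 0 => V 0
  | j + 1 => fun y κ => if BondTouches (Lam L Ω k (j + 1)) y κ then V (j + 1) y κ else avgIter L (V j) 1 y κ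

/-- A bond of a plaquette of (7) at level `j`: it touches `Λ_j` ("belongs to Λ_j"), or it lies outside `Ω_j^{(j)}`
(print: "then it means that y, z ∈ Λ_{j−1}", the bonds carrying `V̄`) (M4). [cite: Balaban1985Variational, p.278 (explanation of (7))] -/
def BondOK (L k : ℕ) (Ω : ℕ → Set (Site d)) (j : ℕ) (x : Site d) (κ : Fin d) : Prop :=
  BondTouches (Lam L Ω k j) x κ ∨ (loK L j x ∉ Ω j ∧ loK L j (x + e κ) ∉ Ω j)

/-- **The plaquettes `p′ ∈ 𝔅_k` of (7) at level `j`** ("for some j between 0 and k p′ ∈ Λ_j"): `p′` touches `Λ_j`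
and each of its four bonds touches `Λ_j` or lies outside `Ω_j^{(j)}` — the plaquettes for which print defines
`(∂V)(p′)` (M4). [cite: Balaban1985Variational, (7) p.278] -/
def PlaqB (L k : ℕ) (Ω : ℕ → Set (Site d)) (j : ℕ) (y : Site d) (μ ν : Fin d) : Prop :=
  PlaqTouches (Lam L Ω k j) y μ ν ∧ BondOK L k Ω j y μ ∧ BondOK L k Ω j (y + e μ) ν ∧
    BondOK L k Ω j (y + e ν) μ ∧ BondOK L k Ω j y ν

omit [NormOneClass 𝔸] in
/-- **(7) `|(∂V)(p′) − 1| < ε₁ for p′ ∈ 𝔅_k`**, with the printed meaning of `(∂V)(p′)` (`effCfg`, `PlaqB`).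
[cite: Balaban1985Variational, (7) p.278] -/
def Reg7 (L k : ℕ) (Ω : ℕ → Set (Site d)) (ε₁ : ℝ) (V : ℕ → Site d → Fin d → 𝔸ˣ) : Prop :=
  ∀ j, j ≤ k → ∀ (y : Site d) (μ ν : Fin d), μ ≠ ν → PlaqB L k Ω j y μ ν →
    ‖plaqF (effCfg L k Ω V j) μ ν y - 1‖ < ε₁

end Objects

/-! ## §3 The concrete model of the carrier `B11.VarProblem` (rows B11.Eq2/Eq3/Eq7 fields concrete, the rest arbitrary) -/

section Concrete

variable {𝔸 : Type} [NormedRing 𝔸] [NormOneClass 𝔸] [NormedAlgebra ℂ 𝔸] [CompleteSpace 𝔸]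

variable (d 𝔸) in
/-- The data of `B11.VarProblem` which the remark does not involve (cubes and their scales, the orbit predicates of
(5)/(6), the gauge `u` and the norms of (9)–(10): fields `Cube`, `scale`, `sizeM`, `OnMinimalOrbit`,
`UniqueCriticalOrbit`, `Gauged`, `normA`, `normGradA`, `holderA`, `normLapA` of `B11.VarProblem`), over the concrete
configuration / boundary-data types; kept ARBITRARY (the discharge in `B11Rem278` holds for every choice).
[cite: Balaban1985Variational, (2)–(8) p.278] -/
structure OtherData (G : Subgroup 𝔸ˣ) where
  Cube : Type
  scale : Cube → ℕ
  sizeM : Cube → ℝ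
  OnMinimalOrbit : ℝ → (ℕ → Site d → Fin d → 𝔸ˣ) → {U : Site d → Fin d → 𝔸ˣ // ∀ x κ, U x κ ∈ G} → Prop
  UniqueCriticalOrbit : ℝ → (ℕ → Site d → Fin d → 𝔸ˣ) → {U : Site d → Fin d → 𝔸ˣ // ∀ x κ, U x κ ∈ G} → Prop
  Gauged : {U : Site d → Fin d → 𝔸ˣ // ∀ x κ, U x κ ∈ G} → Cube → Prop
  normA : {U : Site d → Fin d → 𝔸ˣ // ∀ x κ, U x κ ∈ G} → Cube → ℝ
  normGradA : {U : Site d → Fin d → 𝔸ˣ // ∀ x κ, U x κ ∈ G} → Cube → ℝ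
  holderA : {U : Site d → Fin d → 𝔸ˣ // ∀ x κ, U x κ ∈ G} → Cube → ℝ → ℝ
  normLapA : {U : Site d → Fin d → 𝔸ˣ // ∀ x κ, U x κ ∈ G} → Cube → ℝ

variable (d) in
/-- Index of the concrete family for fixed `(d, L)` and gauge group `G`: the geometric datum `(k; Ω₀ ⊃ … ⊃ Ω_k)`
(admissible). [cite: Balaban1985Variational, (1) p.277] -/
structure GeomDatum (L : ℕ) where
  /-- number of levels -/
  k : ℕ
  /-- the domains `Ω_j ⊂ T_η` as fine site sets (`Ω_j = ∅` for `j > k`) -/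
  Ω : ℕ → Set (Site d)
  /-- admissibility (1) = (1.3)–(1.4) of [6] -/
  adm : DomainSeq L Ω
  /-- `Ω₀ = T_η` -/
  top : Ω 0 = Set.univ

variable (d 𝔸) in
/-- **The concrete model of the carrier `B11.VarProblem`** for the geometric datum `i` and gauge group `G`:
`Cfg` = `G`-valued configurations on `T_η ≅ ℤ^d`, `η = L^{−k}`; `Bdry` = level-indexed data `V`; `InU ε₀ U` = (2)
`U ∈ 𝔘_k({Ω_j}, ε₀)` (`B8Ineq132.InAk`); `InB V U` = (3); `Reg7 ε₁ V` = (7) with its boundary convention; all other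
fields = the arbitrary `X`. [cite: Balaban1985Variational, (2)–(8) p.278] -/
def concreteVarProblem (L : ℕ) (G : Subgroup 𝔸ˣ) (X : OtherData d 𝔸 G) (i : GeomDatum d L) : B11.VarProblem where
  Cfg := {U : Site d → Fin d → 𝔸ˣ // ∀ x κ, U x κ ∈ G}
  Bdry := ℕ → Site d → Fin d → 𝔸ˣ
  Cube := X.Cube
  scale := X.scale
  sizeM := X.sizeM
  eta := (((L : ℝ) ^ i.k)⁻¹)
  L := L
  InU ε₀ U := InAk L i.k (((L : ℝ) ^ i.k)⁻¹) ε₀ i.Ω U.1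
  InB V U := InB L i.k i.Ω V U.1
  Reg7 ε₁ V := Reg7 L i.k i.Ω ε₁ V
  OnMinimalOrbit := X.OnMinimalOrbit
  UniqueCriticalOrbit := X.UniqueCriticalOrbit
  Gauged := X.Gauged
  normA := X.normA
  normGradA := X.normGradA
  holderA := X.holderA
  normLapA := X.normLapA

end Concrete

end Literature.MathematicalPhysics.QuantumFieldTheory.Balaban1983to89.B11Eq7Convention
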